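import Summits.QuantumFields.BalabanUV.T4Continuum.Spine.NE1p.DressedMGFForm

/-!
# T⁴ programme, spine estimate NE1′ — the two-run binder lives on ONE space: push-forward of the MGF form to the unit lattice

Cell `pub-balaban-gaps` (track G2), seat `ne1` gen 2, record `HOME/ne/NE1.md` v2 §3 remark (a); ADDITIVE — imports the seat's
`DressedMGFForm` only, modifies nothing.

WHAT THIS IS.  The observable of the T⁴ programme is a unit-scale averaged loop variable: on the original field space `Ω K` of
the run with `K` steps it is `F K = W ∘ A K` with `A K = avg^K` the `K`-fold block averaging to the UNIT-LATTICE field space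
`X` (one space for all `K`; `T4VarianceMatching.UnitFactorisation`) and `W` the unit-lattice loop variable.  Hence every MGF
of `F K` under a measure `ν` on `Ω K` is the MGF of `W` under the push-forward `ν.map (A K)` on `X` (Mathlib `mgf_map`), the
tilted means agree (`tiltedMean_comp_eq`), an `MGFForm` on the original spaces pushes forward to an `MGFForm` on the ONE space
`X` (`MGFForm.map`), and the two-run binder `TiltedMeanMatching` for runs A and B is LITERALLY the same statement for the
two families of unit-lattice measures `π K τ = (ν K τ).map (A K)`, `π' K τ = (ν' K τ).map (A' K)` and the one observable `W`
(`tiltedMeanMatching_iff_map`); and under the dictionary `Σ_τ ν K τ = μ_K` the pieces `π K τ` exhaust the TRUE unit-lattice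
marginal `μ_K.map (A K)` (`sum_map_eq_marginal`) — the NE7-P3 lineage's `effLaw`, not Bałaban's final density: in convention (α)
the history expansion DECOMPOSES the true marginal into positive history pieces on `X`, and the binder compares the two runs'
pieces class by class on the tilted loop variable.

WHAT THIS IS NOT.  Not NE1′, not the binder; nothing instantiated on Bałaban's densities; spine PROVED 0∕9; (B) 0∕13.  Rung
(B)+1 bookkeeping on ONE finite four-torus — NOT infinite volume, NOT a mass gap, NOT OS on ℝ⁴, NOT Clay.  [folklore] throughout.
-/

noncomputable section

namespace Summit.QuantumFields.BalabanUV.T4Continuum.NE1p.DressedMGFForm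

open MeasureTheory ProbabilityTheory Finset

section UnitLattice

variable {Ω X : Type*} [MeasurableSpace Ω] [MeasurableSpace X]

/-- The MGF of `W ∘ A` under `ν` is the MGF of `W` under `ν.map A` (Mathlib `mgf_map`). [folklore] -/
theorem mgf_comp_eq_mgf_map {A : Ω → X} (hA : Measurable A) {W : X → ℝ} (hW : Measurable W) (ν : Measure Ω) (t : ℝ) :
    mgf (W ∘ A) ν t = mgf W (ν.map A) t :=
  (mgf_map hA.aemeasurable ((Real.measurable_exp.comp (hW.const_mul t)).aestronglyMeasurable)).symm

/-- … hence so is the cumulant generating function. [folklore] -/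
theorem cgf_comp_eq_cgf_map {A : Ω → X} (hA : Measurable A) {W : X → ℝ} (hW : Measurable W) (ν : Measure Ω) :
    cgf (W ∘ A) ν = cgf W (ν.map A) := by
  funext t
  simp only [cgf, mgf_comp_eq_mgf_map hA hW]

/-- **TILTED MEANS LIVE ON THE UNIT LATTICE**: the source-tilted mean of `W ∘ A` under `ν` is that of `W` under `ν.map A`.
[folklore] -/
theorem tiltedMean_comp_eq {A : Ω → X} (hA : Measurable A) {W : X → ℝ} (hW : Measurable W) {B : ℝ} (hWb : ∀ x, |W x| ≤ B)
    (ν : Measure Ω) [IsFiniteMeasure ν] (s : ℝ) : tiltedMean (W ∘ A) ν s = tiltedMean W (ν.map A) s := by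
  haveI : IsFiniteMeasure (ν.map A) := Measure.isFiniteMeasure_map ν A
  rw [← deriv_cgf_eq_tiltedMean (hW.comp hA) (fun ω => hWb (A ω)), ← deriv_cgf_eq_tiltedMean hW hWb,
    cgf_comp_eq_cgf_map hA hW]

variable {ι : Type*} {Ωs : ℕ → Type*} [∀ K, MeasurableSpace (Ωs K)] {B : ℝ} {T : ℕ → Finset ι}

/-- **AN MGF FORM PUSHES FORWARD TO THE UNIT LATTICE**: if the observable factors as `F K = W ∘ A K` through measurable maps
`A K : Ω K → X` to one space, the family is in MGF form over `X` with the ONE observable `W` and the push-forward measures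
`(ν K τ).map (A K)`. [folklore] -/
theorem MGFForm.map {A : ∀ K, Ωs K → X} (hA : ∀ K, Measurable (A K)) {W : X → ℝ} (hW : Measurable W)
    (hWb : ∀ x, |W x| ≤ B) {ν : ∀ K, ι → Measure (Ωs K)} {Af : ℕ → ℝ → ι → ℝ}
    (h : MGFForm B T (fun K => W ∘ A K) ν Af) :
    MGFForm B T (fun _ => W) (fun K τ => (ν K τ).map (A K)) Af where
  nonneg := h.nonneg
  meas := fun _ => hW
  bound := fun _ x => hWb x
  finite := fun K τ hτ => by haveI := h.finite K τ hτ; exact Measure.isFiniteMeasure_map _ _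
  repr := fun K t τ hτ => by rw [h.repr K t τ hτ, mgf_comp_eq_mgf_map (hA K) hW]

variable [DecidableEq ι] {Ωs' : ℕ → Type*} [∀ K, MeasurableSpace (Ωs' K)]

/-- **THE BINDER LIVES ON ONE SPACE**: `TiltedMeanMatching` for two runs whose observables factor through the unit lattice is
the same statement for the two families of push-forward measures on `X` and the one observable `W`. [folklore] -/
theorem tiltedMeanMatching_iff_map {l₀ : ℝ} {Bad : ℕ → ℝ → Finset ι} {A : ∀ K, Ωs K → X} {A' : ∀ K, Ωs' K → X}
    (hA : ∀ K, Measurable (A K)) (hA' : ∀ K, Measurable (A' K)) {W : X → ℝ} (hW : Measurable W) (hWb : ∀ x, |W x| ≤ B)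
    {ν : ∀ K, ι → Measure (Ωs K)} {ν' : ∀ K, ι → Measure (Ωs' K)} (hν : ∀ K, ∀ τ ∈ T K, IsFiniteMeasure (ν K τ))
    (hν' : ∀ K, ∀ τ ∈ T K, IsFiniteMeasure (ν' K τ)) (η : ℕ → ℝ) :
    TiltedMeanMatching l₀ T Bad (fun K => W ∘ A K) ν (fun K => W ∘ A' K) ν' η ↔
      TiltedMeanMatching l₀ T Bad (fun _ => W) (fun K τ => (ν K τ).map (A K)) (fun _ => W)
        (fun K τ => (ν' K τ).map (A' K)) η := by
  unfold TiltedMeanMatching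
  refine forall₂_congr fun K t => forall_congr' fun _ => forall₂_congr fun τ hτ => forall₂_congr fun s _ => ?_
  have hτT : τ ∈ T K := (Finset.mem_sdiff.mp hτ).1
  haveI := hν K τ hτT
  haveI := hν' K τ hτT
  rw [tiltedMean_comp_eq (hA K) hW hWb, tiltedMean_comp_eq (hA' K) hW hWb]

omit [DecidableEq ι] in
/-- Push-forward is additive over a finite family of measures (Mathlib `Measure.mapₗ`). [folklore] -/
theorem map_finset_sum {A : Ω → X} (hA : Measurable A) (s : Finset ι) (ν : ι → Measure Ω) :
    (∑ τ ∈ s, ν τ).map A = ∑ τ ∈ s, (ν τ).map A := by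
  rw [← Measure.mapₗ_apply_of_measurable hA, map_sum]
  exact Finset.sum_congr rfl fun τ _ => Measure.mapₗ_apply_of_measurable hA _

omit [DecidableEq ι] in
/-- **THE HISTORY EXPANSION DECOMPOSES THE TRUE UNIT-LATTICE MARGINAL.**  If the history-conditioned measures of the run with
`K` steps exhaust its Gibbs measure `μ` (the dictionary `Σ_τ ν K τ = μ` of convention (α): the dressed (1.102) summed over the
terms and iterated), then their push-forwards `π K τ = (ν K τ).map (A K)` exhaust the TRUE marginal law `μ.map (A K)` of the
unit-lattice field — the `effLaw` of the NE7-P3 lineage (`T4VarianceMatching.UnitFactorisation`), NOT Bałaban's final density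
`ρ_K dV` (which differs from it by the ℝ-defects, `T4DressedR.naive_dressing_witness`). [folklore] -/
theorem sum_map_eq_marginal {K : ℕ} {A : ∀ K, Ωs K → X} (hA : ∀ K, Measurable (A K)) {ν : ∀ K, ι → Measure (Ωs K)}
    {μ : Measure (Ωs K)} (hdict : ∑ τ ∈ T K, ν K τ = μ) : ∑ τ ∈ T K, (ν K τ).map (A K) = μ.map (A K) := by
  rw [← hdict, map_finset_sum (hA K)]

end UnitLattice

end Summit.QuantumFields.BalabanUV.T4Continuum.NE1p.DressedMGFForm

end
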